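import Summits.HubbardSuperconductivity.HubbardSuperconductivity.Theorems.InfiniteVolumeFirstNoNormalLimitStateSourcedPenalty
import Summits.HubbardSuperconductivity.HubbardSuperconductivity.Theorems.NodalDiracTwistBridgeNodalToDWaveEnergyMatching
import HarnessLib

/-!
# Crux `NoNormalLimitState` (stmt-HubbardSuperconductivity-18533), idea `sourced-penalty-trial-state`, part 2:
# penalised sourced order of ONE grand-canonical family + `T = 0` ensemble equivalence ⇒ the window chord ⇒ the crux

Sequel of `InfiniteVolumeFirstNoNormalLimitStateSourcedPenalty.lean` (the finite-`L` inequalities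
`stub_sourcedChord`, `groundEnergy_le_minEnergyOn_sector_sub`). Here the limits are composed:

* `windowGapCofinal_of_penalisedSourcedOrder` — hypothesis: at one doping `δ ∈ (0,1/2)` and cofinally small
  `U > 0` there is a chemical potential `μ` with (i) `minE_sec(H_U)(N_L) − μ N_L − E₀(H_U − μN) = o(L²)` along
  even `L` (zero-temperature equivalence of ensembles at `μ`) and (ii) a floor `m⋆ > 0` on the tracial `d`-wave
  density of the ground state of `H_U − μN + λW_ε − h(Δ_d + Δ_dᴴ)` for every window `ε > 0`, every penalty
  `λ ∈ (0, λ₀(ε))`, every source `h ∈ (0, h₀)` and all large even `L`; conclusion: the registered hard stub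
  `stub_windowGapCofinal` of line `window-gap-transfer`, verbatim, with `a = m⋆²/4`;
* `stub_penalisedSourcedOrderTransfer` (registered stub on the crux item) — the same hypothesis implies
  `NoNormalLimitState`, through the landed `noNormalLimitState_of_windowGapCofinal`;
* `noNormalLimitState_of_penalisedSourcedOrder_subgradient`, `…_densityMatched` — the ensemble clause (i)
  DISCHARGED by the tree's zero-temperature equivalence of ensembles (`energyMatching_of_subgradient`,
  `subgradient_of_densityMatching`, route `NodalDiracTwist`): it suffices that `μ` is a subgradient of the
  limiting canonical energy density `energyDensity2D 1 U` at `1 − δ`, or — in the supplier's own currency — that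
  the grand-canonical tracial density of `H_U − μN` tends to `1 − δ`. Net reduction: the crux follows from
  penalised sourced Koma–Tasaki `d`-wave order of ONE density-matched grand-canonical family at one doping and
  cofinally small `U`.

Folklore bookkeeping of limits (Koma–Tasaki, J. Stat. Phys. 76 (1994) 745, §1; Tasaki 2020 §2.1). No new
definitions; no named facts.
-/

noncomputable section

set_option linter.dupNamespace false

namespace Summit.HubbardSuperconductivity.HubbardSuperconductivity.Theorems.NoNormalLimitState

open Literature.MathematicalPhysics.QuantumLattice Literature.Probability.LatticeModels Matrix Finset
  Filter
open Summit.HubbardSuperconductivity.HubbardSuperconductivity.Theses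
open Summit.HubbardSuperconductivity.HubbardSuperconductivity.Theorems.CwSsbToEvenTorusLRO.Negative
  (isHermitian_add_real_smul)
open Summit.HubbardSuperconductivity.HubbardSuperconductivity.Theorems.NodalDiracTwist.BridgeNodalToDWave
  (energyMatching_of_subgradient subgradient_of_densityMatching)
open Literature.MathematicalPhysics.QuantumLattice.ThermodynamicLimit (energyDensity2D)
open scoped ComplexConjugate ComplexOrder Topology Matrix.Norms.L2Operator

/-! ### 5. The composition: penalised sourced order + `T = 0` ensemble equivalence ⇒ the chord ⇒ the crux -/

section Composition

/-- **The window chord from one penalised sourced family.** Suppose that at some doping `δ ∈ (0,1/2)`,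
for every `U₀ > 0` there are a coupling `U ∈ (0,U₀)` and a chemical potential `μ` such that
(i) (`T = 0` EQUIVALENCE OF ENSEMBLES at `μ`) the canonical sector energy at `N_L = 2⌊(1−δ)L²/2⌋` sits within
`o(L²)` of the grand-canonical ground energy plus `μ N_L`, and (ii) (PENALISED SOURCED ORDER) for some `m⋆ > 0`,
every window `ε > 0`, every penalty `λ` below some `λ₀(ε) > 0`, every source `h` below some `h₀ > 0` and all
large even `L`, the tracial `d`-wave density `Re ω(Δ_d)/L²` of the ground state of
`H_U − μN + λ W_ε − h(Δ_d + Δ_dᴴ)` is at least `m⋆`. Then the registered hard stub `stub_windowGapCofinal` of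
line `window-gap-transfer` holds, with `a = m⋆²/4`: by `stub_sourcedChord` and the sector floor
`groundEnergy_le_minEnergyOn_sector_sub`, `minE_sec(H + λW_ε) − minE_sec(H) ≥ λ L² m⋆² − 24 h L² − κ L²`, and
`h`, `κ` are chosen as small multiples of `λ m⋆²`. Koma–Tasaki, J. Stat. Phys. 76 (1994) 745, §1;
Tasaki (2020) §2.1. [folklore] -/
theorem windowGapCofinal_of_penalisedSourcedOrder
    (hyp : ∃ δ ∈ Set.Ioo (0:ℝ) (1 / 2), ∀ U₀ : ℝ, 0 < U₀ → ∃ U ∈ Set.Ioo (0:ℝ) U₀, ∃ μ : ℝ,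
      (∀ κ : ℝ, 0 < κ → ∃ L₀ : ℕ, ∀ (L : ℕ) [NeZero L], Even L → L₀ ≤ L →
        (hubbardTorus 2 L 1 U).minEnergyOn (szSector (2 * ⌊(1 - δ) * (L : ℝ) ^ 2 / 2⌋₊) 0) -
            μ * ((2 * ⌊(1 - δ) * (L : ℝ) ^ 2 / 2⌋₊ : ℕ) : ℝ) -
          (hubbardTorusWith 2 L 1 U μ).groundEnergy ≤ κ * (L : ℝ) ^ 2) ∧
      ∃ mstar : ℝ, 0 < mstar ∧ ∀ ε : ℝ, 0 < ε → ∃ lam₀ : ℝ, 0 < lam₀ ∧ ∀ lam ∈ Set.Ioo (0:ℝ) lam₀,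
        ∃ h₀ : ℝ, 0 < h₀ ∧ ∀ h ∈ Set.Ioo (0:ℝ) h₀, ∃ L₀ : ℕ, ∀ (L : ℕ) [NeZero L], Even L → L₀ ≤ L →
          mstar ≤ ((hubbardTorusWith 2 L 1 U μ + (lam : ℂ) • (∑ m : TorusSite 2 L,
              if momentumNormSq L m ≤ ε ^ 2 then
                ((L : ℂ) ^ 2)⁻¹ • ((pairFieldAt dWaveFormFactor L m)ᴴ * pairFieldAt dWaveFormFactor L m)
              else 0) -
              (h : ℂ) • (pairField dWaveFormFactor L + (pairField dWaveFormFactor L)ᴴ)).groundStateFunctional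
            (pairField dWaveFormFactor L)).re / (L : ℝ) ^ 2) :
    ∃ δ ∈ Set.Ioo (0:ℝ) (1 / 2), ∀ U₀ : ℝ, 0 < U₀ → ∃ U ∈ Set.Ioo (0:ℝ) U₀, ∃ a : ℝ, 0 < a ∧
      ∀ ε : ℝ, 0 < ε → ∃ lam : ℝ, 0 < lam ∧ ∃ L₀ : ℕ, ∀ (L : ℕ) [NeZero L], Even L → L₀ ≤ L →
        lam * a * (L : ℝ) ^ 2 ≤
          (hubbardTorus 2 L 1 U + (lam : ℂ) • ∑ m : TorusSite 2 L,
              if momentumNormSq L m ≤ ε ^ 2 then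
                ((L : ℂ) ^ 2)⁻¹ •
                  ((pairFieldAt dWaveFormFactor L m)ᴴ * pairFieldAt dWaveFormFactor L m)
              else 0).minEnergyOn (szSector (2 * ⌊(1 - δ) * (L : ℝ) ^ 2 / 2⌋₊) 0) -
            (hubbardTorus 2 L 1 U).minEnergyOn (szSector (2 * ⌊(1 - δ) * (L : ℝ) ^ 2 / 2⌋₊) 0) := by
  obtain ⟨δ, hδ, hU⟩ := hyp
  refine ⟨δ, hδ, fun U₀ hU₀ => ?_⟩
  obtain ⟨U, hUmem, μ, hELZ, mstar, hmstar, hord⟩ := hU U₀ hU₀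
  refine ⟨U, hUmem, mstar ^ 2 / 4, by positivity, fun ε hε => ?_⟩
  obtain ⟨lam₀, hlam₀, hlam⟩ := hord ε hε
  -- the penalty: `λ := λ₀/2`
  have hlmem : lam₀ / 2 ∈ Set.Ioo (0:ℝ) lam₀ := ⟨by positivity, by linarith⟩
  obtain ⟨h₀, hh₀, hh⟩ := hlam (lam₀ / 2) hlmem
  -- the source: `h := min (h₀/2) (λ m⋆²/100)`
  set h : ℝ := min (h₀ / 2) (lam₀ / 2 * mstar ^ 2 / 100) with hdef
  have hhpos : 0 < h := lt_min (by positivity) (by positivity)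
  have hhmem : h ∈ Set.Ioo (0:ℝ) h₀ := ⟨hhpos, lt_of_le_of_lt (min_le_left _ _) (by linarith)⟩
  have hhle : h ≤ lam₀ / 2 * mstar ^ 2 / 100 := min_le_right _ _
  obtain ⟨L₁, hL₁⟩ := hh h hhmem
  -- the ensemble-equivalence slack: `κ := λ m⋆²/4`
  obtain ⟨L₂, hL₂⟩ := hELZ (lam₀ / 2 * mstar ^ 2 / 4) (by positivity)
  refine ⟨lam₀ / 2, by positivity, max L₁ L₂, fun L _ hLe hLge => ?_⟩
  have hord' := hL₁ L hLe (le_of_max_le_left hLge)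
  have helz' := hL₂ L hLe (le_of_max_le_right hLge)
  have hchord := stub_sourcedChord L U μ ε (lam₀ / 2) h (by positivity) hhpos.le
  -- the sector floor for `H + λ W_ε`, sector `(N_L, 0)` (non-empty: a sector ground state exists)
  have hn : ⌊(1 - δ) * (L : ℝ) ^ 2 / 2⌋₊ ≤ L ^ 2 :=
    Summit.HubbardSuperconductivity.NoGo.floor_pairNumber_le δ (by linarith [hδ.1]) L
  obtain ⟨φ, -, hφS, hφ0, -⟩ :=
    Summit.HubbardSuperconductivity.NoGo.exists_unit_groundStateInSector_hubbardTorus L 1 U hn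
  have hHerm : (hubbardTorus 2 L 1 U - (μ : ℂ) • totalNumber + (((lam₀ / 2 : ℝ) : ℂ) •
      ∑ m : TorusSite 2 L, if momentumNormSq L m ≤ ε ^ 2 then
        ((L : ℂ) ^ 2)⁻¹ • ((pairFieldAt dWaveFormFactor L m)ᴴ * pairFieldAt dWaveFormFactor L m)
        else 0)).IsHermitian := by
    rw [← hubbardTorusWith_eq]
    exact isHermitian_add_real_smul (isHermitian_hubbardTorusWith L 1 U μ) (isHermitian_windowOp L ε) _
  have hfloor := groundEnergy_le_minEnergyOn_sector_sub (hubbardTorus 2 L 1 U) _ μ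
    (2 * ⌊(1 - δ) * (L : ℝ) ^ 2 / 2⌋₊) 0 hHerm ⟨φ, hφS, hφ0⟩
  rw [← hubbardTorusWith_eq] at hfloor
  -- bookkeeping
  have hL : (0 : ℝ) < (L : ℝ) ^ 2 := cast_sq_pos_of_neZero L
  set mL := ((hubbardTorusWith 2 L 1 U μ + (((lam₀ / 2 : ℝ)) : ℂ) • (∑ m : TorusSite 2 L,
      if momentumNormSq L m ≤ ε ^ 2 then
        ((L : ℂ) ^ 2)⁻¹ • ((pairFieldAt dWaveFormFactor L m)ᴴ * pairFieldAt dWaveFormFactor L m)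
      else 0) -
      (h : ℂ) • (pairField dWaveFormFactor L + (pairField dWaveFormFactor L)ᴴ)).groundStateFunctional
        (pairField dWaveFormFactor L)).re / (L : ℝ) ^ 2 with hmL
  have hsq : mstar ^ 2 ≤ mL ^ 2 := pow_le_pow_left₀ hmstar.le hord' 2
  have h1 : lam₀ / 2 * (L : ℝ) ^ 2 * mstar ^ 2 ≤ lam₀ / 2 * (L : ℝ) ^ 2 * mL ^ 2 :=
    mul_le_mul_of_nonneg_left hsq (by positivity)
  have h2 : 24 * h * (L : ℝ) ^ 2 ≤ 24 * (lam₀ / 2 * mstar ^ 2 / 100) * (L : ℝ) ^ 2 := by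
    gcongr
  have hP : 0 ≤ lam₀ / 2 * mstar ^ 2 * (L : ℝ) ^ 2 := by positivity
  have key : lam₀ / 2 * (mstar ^ 2 / 4) * (L : ℝ) ^ 2 ≤
      lam₀ / 2 * (L : ℝ) ^ 2 * mL ^ 2 - 24 * h * (L : ℝ) ^ 2 - lam₀ / 2 * mstar ^ 2 / 4 * (L : ℝ) ^ 2 := by
    linarith
  linarith [key, hchord, hfloor, helz']

/-- **Idea `sourced-penalty-trial-state` as an implication (registered stub): penalised sourced `d`-wave order
of ONE grand-canonical family, at a density-matched chemical potential, implies `NoNormalLimitState`.**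
The hypothesis is that of `windowGapCofinal_of_penalisedSourcedOrder` — at one doping `δ ∈ (0,1/2)` and
cofinally small `U > 0`: zero-temperature equivalence of ensembles at some `μ` (the canonical sector energy
at `N_L = 2⌊(1−δ)L²/2⌋` is within `o(L²)` of `E₀(H_U − μN) + μN_L`) and a Koma–Tasaki floor `m⋆ > 0` on the
tracial `d`-wave density of the ground state of `H_U − μN + λW_ε − h(Δ_d + Δ_dᴴ)` for every window `ε`,
every small penalty `λ`, every small source `h` and all large even `L` (source AFTER volume: `h` is fixed
while `L → ∞`). The conclusion is the crux: the chord (`windowGapCofinal_of_penalisedSourcedOrder`) feeds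
the landed composition `noNormalLimitState_of_windowGapCofinal` (sandwich `windowFloor_of_windowGap` +
`stub_windowFloorAtom`). So the every-ground-state content of the crux is discharged by the variational
sandwich, and what remains is a statement about ONE sourced family in the output format of constructive
weak-coupling expansions (Koma–Tasaki 1994 §1; cf. the sibling interface `WcbcsBcsConstruction`).
Koma–Tasaki, J. Stat. Phys. 76 (1994) 745, §1; Tasaki (2020) §2.1. [folklore] -/
theorem stub_penalisedSourcedOrderTransfer :
    (∃ δ ∈ Set.Ioo (0:ℝ) (1 / 2), ∀ U₀ : ℝ, 0 < U₀ → ∃ U ∈ Set.Ioo (0:ℝ) U₀, ∃ μ : ℝ,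
      (∀ κ : ℝ, 0 < κ → ∃ L₀ : ℕ, ∀ (L : ℕ) [NeZero L], Even L → L₀ ≤ L →
        (hubbardTorus 2 L 1 U).minEnergyOn (szSector (2 * ⌊(1 - δ) * (L : ℝ) ^ 2 / 2⌋₊) 0) -
            μ * ((2 * ⌊(1 - δ) * (L : ℝ) ^ 2 / 2⌋₊ : ℕ) : ℝ) -
          (hubbardTorusWith 2 L 1 U μ).groundEnergy ≤ κ * (L : ℝ) ^ 2) ∧
      ∃ mstar : ℝ, 0 < mstar ∧ ∀ ε : ℝ, 0 < ε → ∃ lam₀ : ℝ, 0 < lam₀ ∧ ∀ lam ∈ Set.Ioo (0:ℝ) lam₀,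
        ∃ h₀ : ℝ, 0 < h₀ ∧ ∀ h ∈ Set.Ioo (0:ℝ) h₀, ∃ L₀ : ℕ, ∀ (L : ℕ) [NeZero L], Even L → L₀ ≤ L →
          mstar ≤ ((hubbardTorusWith 2 L 1 U μ + (lam : ℂ) • (∑ m : TorusSite 2 L,
              if momentumNormSq L m ≤ ε ^ 2 then
                ((L : ℂ) ^ 2)⁻¹ • ((pairFieldAt dWaveFormFactor L m)ᴴ * pairFieldAt dWaveFormFactor L m)
              else 0) -
              (h : ℂ) • (pairField dWaveFormFactor L + (pairField dWaveFormFactor L)ᴴ)).groundStateFunctional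
            (pairField dWaveFormFactor L)).re / (L : ℝ) ^ 2) →
      Summit.HubbardSuperconductivity.HubbardSuperconductivity.Theses.InfiniteVolumeFirst.NoNormalLimitState :=
  fun hyp => noNormalLimitState_of_windowGapCofinal (windowGapCofinal_of_penalisedSourcedOrder hyp)

/-- **The ensemble clause discharged: penalised sourced order at a SUBGRADIENT chemical potential implies the
crux.** If at one doping `δ ∈ (0,1/2)` and cofinally small `U > 0` there is a chemical potential `μ` which is a
subgradient at `1 − δ` of the limiting canonical energy density `e = energyDensity2D 1 U` on `[0,2)`
(`e(1−δ) + μ(y − (1−δ)) ≤ e(y)`) and at which the penalised sourced family has a Koma–Tasaki floor `m⋆ > 0`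
(as in `stub_penalisedSourcedOrderTransfer`), then `NoNormalLimitState`: the zero-temperature equivalence of
ensembles `|minE_sec(H_U)(N_L) − μN_L − E₀(H_U − μN)| ≤ κL²` (tree `energyMatching_of_subgradient`,
Ruelle 1969 §3.4 via the thermodynamic limit and convexity of `e`) supplies clause (i).
Ruelle, *Statistical Mechanics* (1969) §3.4; Koma–Tasaki, J. Stat. Phys. 76 (1994) 745, §1. [folklore] -/
theorem noNormalLimitState_of_penalisedSourcedOrder_subgradient
    (hyp : ∃ δ ∈ Set.Ioo (0:ℝ) (1 / 2), ∀ U₀ : ℝ, 0 < U₀ → ∃ U ∈ Set.Ioo (0:ℝ) U₀, ∃ μ : ℝ,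
      (∀ y ∈ Set.Ico (0 : ℝ) 2,
        energyDensity2D 1 U (1 - δ) + μ * (y - (1 - δ)) ≤ energyDensity2D 1 U y) ∧
      ∃ mstar : ℝ, 0 < mstar ∧ ∀ ε : ℝ, 0 < ε → ∃ lam₀ : ℝ, 0 < lam₀ ∧ ∀ lam ∈ Set.Ioo (0:ℝ) lam₀,
        ∃ h₀ : ℝ, 0 < h₀ ∧ ∀ h ∈ Set.Ioo (0:ℝ) h₀, ∃ L₀ : ℕ, ∀ (L : ℕ) [NeZero L], Even L → L₀ ≤ L →
          mstar ≤ ((hubbardTorusWith 2 L 1 U μ + (lam : ℂ) • (∑ m : TorusSite 2 L,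
              if momentumNormSq L m ≤ ε ^ 2 then
                ((L : ℂ) ^ 2)⁻¹ • ((pairFieldAt dWaveFormFactor L m)ᴴ * pairFieldAt dWaveFormFactor L m)
              else 0) -
              (h : ℂ) • (pairField dWaveFormFactor L + (pairField dWaveFormFactor L)ᴴ)).groundStateFunctional
            (pairField dWaveFormFactor L)).re / (L : ℝ) ^ 2) :
    Summit.HubbardSuperconductivity.HubbardSuperconductivity.Theses.InfiniteVolumeFirst.NoNormalLimitState := by
  obtain ⟨δ, hδ, hU⟩ := hyp
  refine stub_penalisedSourcedOrderTransfer ⟨δ, hδ, fun U₀ hU₀ => ?_⟩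
  obtain ⟨U, hUmem, μ, hsub, hord⟩ := hU U₀ hU₀
  refine ⟨U, hUmem, μ, fun κ hκ => ?_, hord⟩
  obtain ⟨L₀, hL₀⟩ := energyMatching_of_subgradient hUmem.1.le (δ := δ) (by linarith [hδ.2])
    (by linarith [hδ.1]) hsub κ hκ
  exact ⟨L₀, fun L _ _ hL => (le_abs_self _).trans (hL₀ L hL)⟩

/-- **The same in the supplier's currency: penalised sourced order at a DENSITY-MATCHED chemical potential
implies the crux.** If at one doping `δ ∈ (0,1/2)` and cofinally small `U > 0` there is `μ` such that the
grand-canonical tracial density of `H_U − μN` on the torus of side `L + 1` tends to `1 − δ` and the penalised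
sourced family at `μ` has a Koma–Tasaki floor, then `NoNormalLimitState` (density matching makes `μ` a
subgradient, tree `subgradient_of_densityMatching`). So the crux is reduced to the `d`-wave order of ONE
density-matched, penalised, sourced grand-canonical family — the output format of a weak-coupling construction.
Ruelle (1969) §3.4; Koma–Tasaki, J. Stat. Phys. 76 (1994) 745, §1. [folklore] -/
theorem noNormalLimitState_of_penalisedSourcedOrder_densityMatched
    (hyp : ∃ δ ∈ Set.Ioo (0:ℝ) (1 / 2), ∀ U₀ : ℝ, 0 < U₀ → ∃ U ∈ Set.Ioo (0:ℝ) U₀, ∃ μ : ℝ,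
      Tendsto (fun L : ℕ => ((hubbardTorusWith 2 (L + 1) 1 U μ).groundStateFunctional
        totalNumber).re / ((L + 1 : ℕ) : ℝ) ^ 2) atTop (𝓝 (1 - δ)) ∧
      ∃ mstar : ℝ, 0 < mstar ∧ ∀ ε : ℝ, 0 < ε → ∃ lam₀ : ℝ, 0 < lam₀ ∧ ∀ lam ∈ Set.Ioo (0:ℝ) lam₀,
        ∃ h₀ : ℝ, 0 < h₀ ∧ ∀ h ∈ Set.Ioo (0:ℝ) h₀, ∃ L₀ : ℕ, ∀ (L : ℕ) [NeZero L], Even L → L₀ ≤ L →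
          mstar ≤ ((hubbardTorusWith 2 L 1 U μ + (lam : ℂ) • (∑ m : TorusSite 2 L,
              if momentumNormSq L m ≤ ε ^ 2 then
                ((L : ℂ) ^ 2)⁻¹ • ((pairFieldAt dWaveFormFactor L m)ᴴ * pairFieldAt dWaveFormFactor L m)
              else 0) -
              (h : ℂ) • (pairField dWaveFormFactor L + (pairField dWaveFormFactor L)ᴴ)).groundStateFunctional
            (pairField dWaveFormFactor L)).re / (L : ℝ) ^ 2) :
    Summit.HubbardSuperconductivity.HubbardSuperconductivity.Theses.InfiniteVolumeFirst.NoNormalLimitState := by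
  obtain ⟨δ, hδ, hU⟩ := hyp
  refine noNormalLimitState_of_penalisedSourcedOrder_subgradient ⟨δ, hδ, fun U₀ hU₀ => ?_⟩
  obtain ⟨U, hUmem, μ, hDM, hord⟩ := hU U₀ hU₀
  exact ⟨U, hUmem, μ, subgradient_of_densityMatching hUmem.1.le (by linarith [hδ.2]) (by linarith [hδ.1])
    μ hDM, hord⟩

end Composition

end Summit.HubbardSuperconductivity.HubbardSuperconductivity.Theorems.NoNormalLimitState

end
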